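import Summits.AtomisticToContinuum.BoseEinsteinCondensation.Theorems.BECSubharmonicContinuationCoreDeficitBoundsKernelBall
import Summits.AtomisticToContinuum.BoseEinsteinCondensation.Theorems.BECSubharmonicContinuationCoreDeficitBoundsWeight
import Summits.AtomisticToContinuum.BoseEinsteinCondensation.Theorems.BECSubharmonicContinuationContinuationToPeriodicBECRadialKernelsBall
import Mathlib.Analysis.SpecialFunctions.Trigonometric.Sinc
import HarnessLib

/-!
# The sphere kernel `W_S(y) = (4π)⁻¹ (1/|y| − 1/S)` in Fourier space
# (route `BECSubharmonicContinuation`, helper for item `ContinuationToPeriodicBEC`, stmt-14585)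

The Green function of the ball `B(0,S) ⊂ ℝ³` for the SPHERICAL mean (the kernel of the classical
identity `⨍_{∂B_S} u − u(0) = ∫_{B_S} Δu · (4π)⁻¹(1/|y| − 1/S) dy`) is
`W_S(y) = (4π)⁻¹ (1/|y| − 1/S)` for `|y| < S`. This file computes its cosine multipliers on balls,
mode by mode, from the two radial Fourier integrals already in the tree
(`CoreDeficitBounds.integral_ball_cos_inner_div_norm`: `∫_{B_ϱ} cos(k·y)/|y| = 2πϱ² sinc²(|k|ϱ/2)`,
and `SubharmonicContinuation.integral_ball_cos_inner`: `∫_{B_ϱ} cos(k·y) = 4π(sin x − x cos x)/|k|³`):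

* `norm_sq_mul_integral_ball_cos_mul_sphereKernel` — the WHOLE ball:
  `|k|² ∫_{B_S} cos(k·y) W_S(y) dy = 1 − sinc(|k|S)` (the multiplier of "1 − spherical mean");
* `norm_sq_mul_integral_core_cos_mul_sphereKernel` — the CORE `B_R ⊆ B_S`:
  `|k|² ∫_{B_R} cos(k·y) W_S(y) dy = (1 − cos x) − (R/S)(sin x − x cos x)/x`, `x = |k|R`, `k ≠ 0`;
* `abs_norm_sq_mul_integral_core_cos_mul_sphereKernel_le` — the crude bound
  `|…| ≤ 4 min(x², 1)` for `0 < R ≤ S` (from `1 − cos x ≤ x²/2`, `|sin x − x cos x| ≤ x³/2`,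
  and `|sin|, |cos| ≤ 1`), and `abs_norm_sq_mul_integral_core_le_fejer` — its comparison
  `≤ 192 (1 − ∏ⱼ sinc²(kⱼR/2))` with the Fejér weight (`min_norm_sq_one_le`);
* integrability and sign facts for `W_S` (`integrableOn_sphereKernel_ball`, `sphereKernel_nonneg`,
  `sphereKernel_le`);
* on the momentum lattice `κₙ = 2πn(i,·)/L` of the torus: off the zero mode `π ≤ |κₙ| L/2`
  (`pi_le_norm_mul_half`), whence the termwise comparison of the BALL multiplier with the sphere
  multiplier, `1 − |B|⁻¹∫_{B_{L/2}} cos(κₙ·y) ≤ 3 (1 − sinc(|κₙ| L/2))` (`one_sub_ballAverage_le`).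

Folklore potential theory / calculus; fully proved, no named facts.
-/

noncomputable section

namespace Summit.AtomisticToContinuum.BoseEinsteinCondensation.Theorems.SubharmonicContinuation

open MeasureTheory Filter Set Metric Real
open scoped ENNReal RealInnerProductSpace
open Literature.MathematicalPhysics.QuantumManyBody.BoseGas (Space)

section Kernel

/-- **Integrability of the sphere kernel on balls**: `y ↦ (4π)⁻¹(1/|y| − 1/S)` is integrable on
every ball of `ℝ³`. [folklore] -/
theorem integrableOn_sphereKernel_ball (S ϱ : ℝ) :
    IntegrableOn (fun y : Space => (4 * π)⁻¹ * (‖y‖⁻¹ - S⁻¹)) (ball (0 : Space) ϱ) :=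
  ((CoreDeficitBounds.integrableOn_inv_norm_ball ϱ).sub
    (integrableOn_const (by exact measure_ball_lt_top.ne))).const_mul _

/-- The sphere kernel is non-negative on the punctured ball: `0 ≤ (4π)⁻¹(1/|y| − 1/S)` for
`0 < |y| < S`. (At `y = 0` Lean's `0⁻¹ = 0` makes the expression `−(4πS)⁻¹`; a null set.)
[folklore] -/
theorem sphereKernel_nonneg {S : ℝ} {y : Space} (hy0 : 0 < ‖y‖) (hyS : ‖y‖ < S) :
    0 ≤ (4 * π)⁻¹ * (‖y‖⁻¹ - S⁻¹) :=
  mul_nonneg (by positivity) (sub_nonneg.2 ((inv_le_inv₀ (hy0.trans hyS) hy0).2 hyS.le))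

/-- The sphere kernel is dominated by the Newton kernel: `(4π)⁻¹(1/|y| − 1/S) ≤ (4π)⁻¹/|y|` for
`S ≥ 0`. [folklore] -/
theorem sphereKernel_le {S : ℝ} (hS : 0 ≤ S) (y : Space) :
    (4 * π)⁻¹ * (‖y‖⁻¹ - S⁻¹) ≤ (4 * π)⁻¹ * ‖y‖⁻¹ :=
  mul_le_mul_of_nonneg_left (sub_le_self _ (inv_nonneg.2 hS)) (by positivity)

/-- **The cosine multiplier of the sphere kernel on a concentric ball**, raw form:
`∫_{B_ϱ} cos(k·y) W_S(y) dy = (4π)⁻¹ ∫_{B_ϱ} cos(k·y)/|y| dy − (4πS)⁻¹ ∫_{B_ϱ} cos(k·y) dy`.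
[folklore] -/
theorem integral_ball_cos_mul_sphereKernel (k : Space) (S ϱ : ℝ) :
    ∫ y in ball (0 : Space) ϱ, Real.cos (∑ j, k j * y j) * ((4 * π)⁻¹ * (‖y‖⁻¹ - S⁻¹)) =
      (4 * π)⁻¹ * (∫ y in ball (0 : Space) ϱ, Real.cos ⟪k, y⟫ / ‖y‖) -
        (4 * π)⁻¹ * S⁻¹ * ∫ y in ball (0 : Space) ϱ, Real.cos ⟪k, y⟫ := by
  have hc : Continuous fun y : Space => Real.cos ⟪k, y⟫ :=
    Real.continuous_cos.comp (continuous_const.inner continuous_id)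
  have h1 : IntegrableOn (fun y : Space => Real.cos ⟪k, y⟫ / ‖y‖) (ball (0 : Space) ϱ) :=
    CoreDeficitBounds.integrableOn_div_norm_ball hc.measurable (fun y => Real.abs_cos_le_one _) ϱ
  have h2 : IntegrableOn (fun y : Space => Real.cos ⟪k, y⟫) (ball (0 : Space) ϱ) :=
    (hc.continuousOn.integrableOn_compact (isCompact_closedBall 0 ϱ)).mono_set ball_subset_closedBall
  have hpt : ∀ y : Space, Real.cos (∑ j, k j * y j) * ((4 * π)⁻¹ * (‖y‖⁻¹ - S⁻¹)) =
      (4 * π)⁻¹ * (Real.cos ⟪k, y⟫ / ‖y‖) - (4 * π)⁻¹ * S⁻¹ * Real.cos ⟪k, y⟫ := by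
    intro y
    rw [CoreDeficitBounds.sum_mul_eq_inner, div_eq_mul_inv]
    ring
  simp_rw [hpt]
  rw [integral_sub (h1.const_mul _) (h2.const_mul _), integral_const_mul, integral_const_mul]

/-- **The whole-ball multiplier of the sphere kernel**:
`|k|² ∫_{B_S} cos(k·y) (4π)⁻¹(1/|y| − 1/S) dy = 1 − sinc(|k|S)` for `S > 0` and every `k ∈ ℝ³`
(both sides vanish at `k = 0`): the spherical mean of `cos(k·y)` over `|y| = S` is `sinc(|k|S)`.
[folklore] -/
theorem norm_sq_mul_integral_ball_cos_mul_sphereKernel (k : Space) {S : ℝ} (hS : 0 < S) :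
    ‖k‖ ^ 2 * ∫ y in ball (0 : Space) S, Real.cos (∑ j, k j * y j) * ((4 * π)⁻¹ * (‖y‖⁻¹ - S⁻¹)) =
      1 - Real.sinc (‖k‖ * S) := by
  rw [integral_ball_cos_mul_sphereKernel k S S, CoreDeficitBounds.integral_ball_cos_inner_div_norm k hS]
  rcases eq_or_ne k 0 with rfl | hk
  · simp
  · have hκ : ‖k‖ ≠ 0 := norm_ne_zero_iff.2 hk
    have hX : ‖k‖ * S ≠ 0 := mul_ne_zero hκ hS.ne'
    rw [integral_ball_cos_inner hk hS.le, Real.sinc_of_ne_zero hX,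
      Real.sinc_of_ne_zero (div_ne_zero hX two_ne_zero), div_pow, Real.sin_sq_eq_half_sub,
      show 2 * (‖k‖ * S / 2) = ‖k‖ * S by ring]
    field_simp
    ring

/-- **The core multiplier of the sphere kernel**: for `k ≠ 0`, `R > 0`, `S > 0`, with `x = |k|R`,
`|k|² ∫_{B_R} cos(k·y) (4π)⁻¹(1/|y| − 1/S) dy = (1 − cos x) − (R/S) · (sin x − x cos x)/x`.
[folklore] -/
theorem norm_sq_mul_integral_core_cos_mul_sphereKernel {k : Space} (hk : k ≠ 0) {R S : ℝ}
    (hR : 0 < R) (hS : 0 < S) :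
    ‖k‖ ^ 2 * ∫ y in ball (0 : Space) R, Real.cos (∑ j, k j * y j) * ((4 * π)⁻¹ * (‖y‖⁻¹ - S⁻¹)) =
      (1 - Real.cos (‖k‖ * R)) -
        R / S * ((Real.sin (‖k‖ * R) - ‖k‖ * R * Real.cos (‖k‖ * R)) / (‖k‖ * R)) := by
  have hκ : ‖k‖ ≠ 0 := norm_ne_zero_iff.2 hk
  have hx : ‖k‖ * R ≠ 0 := mul_ne_zero hκ hR.ne'
  rw [integral_ball_cos_mul_sphereKernel k S R, CoreDeficitBounds.integral_ball_cos_inner_div_norm k hR,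
    integral_ball_cos_inner hk hR.le, Real.sinc_of_ne_zero (div_ne_zero hx two_ne_zero), div_pow,
    Real.sin_sq_eq_half_sub, show 2 * (‖k‖ * R / 2) = ‖k‖ * R by ring]
  field_simp
  ring

end Kernel

section Bounds

/-- `|1 − cos x| ≤ 2 min(x², 1)` for `x ≥ 0`… in the form used below: `1 − cos x ≤ 2 min(x², 1)`.
[folklore] -/
theorem one_sub_cos_le_two_mul_min (x : ℝ) : 1 - Real.cos x ≤ 2 * min (x ^ 2) 1 := by
  rcases le_total (x ^ 2) 1 with h | h
  · rw [min_eq_left h]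
    linarith [Real.one_sub_sq_div_two_le_cos (x := x), sq_nonneg x]
  · rw [min_eq_right h]
    linarith [Real.neg_one_le_cos x]

/-- `|sin x − x cos x| ≤ x³/2` for `0 ≤ x` (from `x − x³/6 ≤ sin x ≤ x` and
`1 − x²/2 ≤ cos x ≤ 1`). [folklore] -/
theorem abs_sin_sub_mul_cos_le {x : ℝ} (h0 : 0 ≤ x) :
    |Real.sin x - x * Real.cos x| ≤ x ^ 3 / 2 := by
  have hs1 := Real.sin_le h0
  have hs2 := Real.sin_ge_sub_cube h0
  have hc1 := Real.cos_le_one x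
  have hc2 := Real.one_sub_sq_div_two_le_cos (x := x)
  rw [abs_le]
  constructor
  · nlinarith
  · nlinarith

/-- **The crude per-mode core bound**: for `x ≥ 0` and `0 ≤ r ≤ 1`,
`|(1 − cos x) − r (sin x − x cos x)/x| ≤ 4 min(x², 1)`. [folklore] -/
theorem abs_coreMultiplier_le {x r : ℝ} (hx : 0 ≤ x) (hr0 : 0 ≤ r) (hr1 : r ≤ 1) :
    |(1 - Real.cos x) - r * ((Real.sin x - x * Real.cos x) / x)| ≤ 4 * min (x ^ 2) 1 := by
  have hmin0 : 0 ≤ min (x ^ 2) 1 := le_min (sq_nonneg _) zero_le_one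
  have hA : |1 - Real.cos x| ≤ 2 * min (x ^ 2) 1 := by
    rw [abs_of_nonneg (sub_nonneg.2 (Real.cos_le_one x))]
    exact one_sub_cos_le_two_mul_min x
  have hB : |(Real.sin x - x * Real.cos x) / x| ≤ 2 * min (x ^ 2) 1 := by
    rcases eq_or_lt_of_le hx with h0 | hpos
    · rw [← h0]; simp
    rw [abs_div, abs_of_pos hpos, div_le_iff₀ hpos]
    rcases le_total x 1 with h1 | h1
    · have hx2 : x ^ 2 ≤ 1 := by nlinarith
      rw [min_eq_left hx2]
      have := abs_sin_sub_mul_cos_le hx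
      nlinarith
    · have hx2 : 1 ≤ x ^ 2 := by nlinarith
      rw [min_eq_right hx2]
      have h3 : |Real.sin x - x * Real.cos x| ≤ 1 + x := by
        calc |Real.sin x - x * Real.cos x| ≤ |Real.sin x| + |x * Real.cos x| := abs_sub _ _
          _ ≤ 1 + x * 1 := by
              rw [abs_mul, abs_of_pos hpos]
              exact add_le_add (Real.abs_sin_le_one x)
                (mul_le_mul_of_nonneg_left (Real.abs_cos_le_one x) hpos.le)
          _ = 1 + x := by ring
      nlinarith
  calc |(1 - Real.cos x) - r * ((Real.sin x - x * Real.cos x) / x)|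
      ≤ |1 - Real.cos x| + |r * ((Real.sin x - x * Real.cos x) / x)| := abs_sub _ _
    _ = |1 - Real.cos x| + r * |(Real.sin x - x * Real.cos x) / x| := by
        rw [abs_mul, abs_of_nonneg hr0]
    _ ≤ 2 * min (x ^ 2) 1 + 1 * (2 * min (x ^ 2) 1) := by
        gcongr
    _ = 4 * min (x ^ 2) 1 := by ring

/-- **The core multiplier is at most `4 min((|k|R)², 1)`** in absolute value, for every `k ∈ ℝ³`
and `0 < R ≤ S`. [folklore] -/
theorem abs_norm_sq_mul_integral_core_cos_mul_sphereKernel_le (k : Space) {R S : ℝ} (hR : 0 < R)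
    (hRS : R ≤ S) :
    |‖k‖ ^ 2 * ∫ y in ball (0 : Space) R, Real.cos (∑ j, k j * y j) * ((4 * π)⁻¹ * (‖y‖⁻¹ - S⁻¹))| ≤
      4 * min ((‖k‖ * R) ^ 2) 1 := by
  have hS : 0 < S := hR.trans_le hRS
  rcases eq_or_ne k 0 with rfl | hk
  · simp
  · rw [norm_sq_mul_integral_core_cos_mul_sphereKernel hk hR hS]
    exact abs_coreMultiplier_le (mul_nonneg (norm_nonneg _) hR.le) (div_nonneg hR.le hS.le)
      ((div_le_one hS).2 hRS)

/-- **One coordinate of the Fejér weight**: `min(t², 1) ≤ 16 (1 − sinc²(t/2))` for every real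
`t` (for `|t| ≤ 2` from `(1 − cos t)(t² + 12) ≤ 6t²`, i.e. `1 − sinc²(t/2) ≥ t²/(t² + 12)`; for
`|t| ≥ 2` from `sinc²(t/2) ≤ 3/4`; both inputs are in `…CoreDeficitBoundsWeight.lean`). [folklore] -/
theorem min_sq_one_le_sixteen_mul (t : ℝ) : min (t ^ 2) 1 ≤ 16 * (1 - Real.sinc (t / 2) ^ 2) := by
  rcases eq_or_ne t 0 with rfl | ht
  · simp
  by_cases h2 : 2 ≤ |t|
  · have h := CoreDeficitBounds.sinc_sq_half_le_of_two_le h2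
    linarith [min_le_right (t ^ 2) 1]
  · push Not at h2
    have ht2 : 0 < t ^ 2 := by positivity
    have ht4 : t ^ 2 ≤ 4 := by
      have := abs_lt.1 h2
      nlinarith [this.1, this.2]
    have key := CoreDeficitBounds.one_sub_cos_mul_sq_add_le t
    rw [CoreDeficitBounds.sinc_half_sq ht]
    have hgoal : t ^ 2 ≤ 16 * (1 - 2 * (1 - Real.cos t) / t ^ 2) := by
      rw [show 16 * (1 - 2 * (1 - Real.cos t) / t ^ 2) = (16 * t ^ 2 - 32 * (1 - Real.cos t)) / t ^ 2 by
        field_simp; ring]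
      rw [le_div_iff₀ ht2]
      nlinarith [Real.cos_le_one t]
    exact (min_le_left _ _).trans hgoal

/-- **The Fejér weight controls `min(|u|², 1)`**: for every `u ∈ ℝ³`,
`min(|u|², 1) ≤ 48 (1 − ∏ⱼ sinc²(uⱼ/2))` (the largest coordinate carries a third of `|u|²`, the
other factors are `≤ 1`). [folklore] -/
theorem min_norm_sq_one_le (u : Space) :
    min (‖u‖ ^ 2) 1 ≤ 48 * (1 - ∏ j, Real.sinc (u j / 2) ^ 2) := by
  set p : Fin 3 → ℝ := fun j => Real.sinc (u j / 2) ^ 2 with hp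
  have hp0 : ∀ j, 0 ≤ p j := fun j => sq_nonneg _
  have hp1 : ∀ j, p j ≤ 1 := fun j => (sq_le_one_iff_abs_le_one _).2 (Real.abs_sinc_le_one _)
  -- a coordinate carrying a third of `|u|²`
  have hsq : ‖u‖ ^ 2 = ∑ j, (u j) ^ 2 := EuclideanSpace.real_norm_sq_eq u
  obtain ⟨j, hj⟩ : ∃ j : Fin 3, ‖u‖ ^ 2 ≤ 3 * (u j) ^ 2 := by
    by_contra h
    push Not at h
    have : ∑ j : Fin 3, 3 * (u j) ^ 2 < ∑ _j : Fin 3, ‖u‖ ^ 2 :=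
      Finset.sum_lt_sum_of_nonempty ⟨0, Finset.mem_univ _⟩ fun j _ => h j
    rw [← Finset.mul_sum, ← hsq, Finset.sum_const, Finset.card_univ, Fintype.card_fin] at this
    simp at this
  -- the product is at most the `j`-th factor
  have hprod : ∏ k, p k ≤ p j := by
    rw [Fin.prod_univ_three]
    have h00 := hp0 0; have h01 := hp0 1; have h02 := hp0 2
    have h10 := hp1 0; have h11 := hp1 1; have h12 := hp1 2
    fin_cases j
    · calc p 0 * p 1 * p 2 ≤ p 0 * 1 * 1 := by gcongr
        _ = p 0 := by ring
    · calc p 0 * p 1 * p 2 ≤ 1 * p 1 * 1 := by gcongr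
        _ = p 1 := by ring
    · calc p 0 * p 1 * p 2 ≤ 1 * 1 * p 2 := by gcongr
        _ = p 2 := by ring
  have h1 := min_sq_one_le_sixteen_mul (u j)
  have hmin : min (‖u‖ ^ 2) 1 ≤ 3 * min ((u j) ^ 2) 1 := by
    rcases le_total ((u j) ^ 2) 1 with h | h
    · rw [min_eq_left h]; exact (min_le_left _ _).trans hj
    · rw [min_eq_right h]; linarith [min_le_right (‖u‖ ^ 2) 1]
  show min (‖u‖ ^ 2) 1 ≤ 48 * (1 - ∏ k, p k)
  calc min (‖u‖ ^ 2) 1 ≤ 3 * min ((u j) ^ 2) 1 := hmin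
    _ ≤ 3 * (16 * (1 - p j)) := by linarith [h1]
    _ ≤ 48 * (1 - ∏ k, p k) := by nlinarith [hprod]

/-- **The per-mode core bound against the Fejér weight**: for every `k ∈ ℝ³` and `0 < R ≤ S`,
`|κ|² |∫_{B_R} cos(k·y) W_S(y) dy| ≤ 192 (1 − ∏ⱼ sinc²(kⱼR/2))`. [folklore] -/
theorem abs_norm_sq_mul_integral_core_le_fejer (k : Space) {R S : ℝ} (hR : 0 < R) (hRS : R ≤ S) :
    |‖k‖ ^ 2 * ∫ y in ball (0 : Space) R, Real.cos (∑ j, k j * y j) * ((4 * π)⁻¹ * (‖y‖⁻¹ - S⁻¹))| ≤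
      192 * (1 - ∏ j, Real.sinc (k j * R / 2) ^ 2) := by
  have h1 := abs_norm_sq_mul_integral_core_cos_mul_sphereKernel_le k hR hRS
  have h2 := min_norm_sq_one_le (R • k)
  have hnorm : ‖R • k‖ ^ 2 = (‖k‖ * R) ^ 2 := by
    rw [norm_smul, Real.norm_eq_abs, abs_of_pos hR]; ring
  have hcoord : ∀ j, (R • k) j / 2 = k j * R / 2 := fun j => by
    rw [PiLp.smul_apply, smul_eq_mul]; ring
  rw [hnorm] at h2
  simp_rw [hcoord] at h2
  linarith

end Bounds

section Lattice

variable {N : ℕ} {L : ℝ} {i : Fin N} {κ : (Fin N × Fin 3 → ℤ) → Space}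

/-- **Off the zero mode the wave number is at least `2π/L`**: if `κₙ ≠ 0` then `π ≤ |κₙ| L/2`
(`n(i,·)` is a non-zero integer vector). [folklore] -/
theorem pi_le_norm_mul_half (hL : 0 < L) (hκ : ∀ n k, κ n k = 2 * Real.pi * (n (i, k) : ℝ) / L)
    {n : Fin N × Fin 3 → ℤ} (hn : κ n ≠ 0) : Real.pi ≤ ‖κ n‖ * (L / 2) := by
  -- some coordinate of `n(i,·)` is a non-zero integer
  obtain ⟨j, hj⟩ : ∃ j, n (i, j) ≠ 0 := by
    by_contra h
    push Not at h
    apply hn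
    ext j
    rw [hκ, h j]
    simp
  have h1 : (1 : ℝ) ≤ |(n (i, j) : ℝ)| := by
    rw [← Int.cast_abs]
    exact_mod_cast Int.one_le_abs hj
  have h2 : |κ n j| ≤ ‖κ n‖ := by
    have h := PiLp.norm_apply_le (κ n) j
    rwa [Real.norm_eq_abs] at h
  have h3 : |κ n j| = 2 * Real.pi * |(n (i, j) : ℝ)| / L := by
    rw [hκ, abs_div, abs_mul, abs_of_pos hL, abs_of_pos (by positivity : (0 : ℝ) < 2 * Real.pi)]
  have h4 : 2 * Real.pi / L ≤ ‖κ n‖ := by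
    calc 2 * Real.pi / L = 2 * Real.pi * 1 / L := by ring
      _ ≤ 2 * Real.pi * |(n (i, j) : ℝ)| / L := by gcongr
      _ = |κ n j| := h3.symm
      _ ≤ ‖κ n‖ := h2
  calc Real.pi = 2 * Real.pi / L * (L / 2) := by field_simp
    _ ≤ ‖κ n‖ * (L / 2) := by gcongr

/-- **The ball multiplier against the sphere multiplier, termwise**: for every mode `n` and
`S = L/2`, `1 − |B_S|⁻¹ ∫_{B_S} cos(κₙ·y) dy ≤ 3 (1 − sinc(|κₙ| S))`. [folklore] -/
theorem one_sub_ballAverage_le (hL : 0 < L) (hκ : ∀ n k, κ n k = 2 * Real.pi * (n (i, k) : ℝ) / L)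
    (n : Fin N × Fin 3 → ℤ) :
    1 - ((volume : Measure Space).real (ball (0 : Space) (L / 2)))⁻¹ *
        ∫ y in ball (0 : Space) (L / 2), Real.cos (∑ k, κ n k * y k) ≤
      3 * (1 - Real.sinc (‖κ n‖ * (L / 2))) := by
  have hS : 0 < L / 2 := by positivity
  set V : ℝ := (volume : Measure Space).real (ball (0 : Space) (L / 2)) with hV
  have hV0 : 0 < V := by
    rw [hV]
    exact ENNReal.toReal_pos (measure_ball_pos volume _ hS).ne' measure_ball_lt_top.ne
  rcases eq_or_ne (κ n) 0 with h0 | h0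
  · -- the zero mode: both sides vanish
    have hcos : ∀ y : Space, Real.cos (∑ k, κ n k * y k) = 1 := fun y => by
      simp [h0]
    simp_rw [hcos]
    rw [setIntegral_const, smul_eq_mul, mul_one, ← hV, inv_mul_cancel₀ hV0.ne', sub_self, h0,
      norm_zero, zero_mul, Real.sinc_zero, sub_self, mul_zero]
  · -- off the zero mode: `|average| ≤ 1` and `sinc ≤ 1/π ≤ 1/3`
    have hav : |V⁻¹ * ∫ y in ball (0 : Space) (L / 2), Real.cos (∑ k, κ n k * y k)| ≤ 1 := by
      rw [abs_mul, abs_of_pos (inv_pos.2 hV0), inv_mul_le_iff₀ hV0, mul_one]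
      have h := norm_setIntegral_le_of_norm_le_const (μ := (volume : Measure Space))
        (s := ball (0 : Space) (L / 2)) (f := fun y => Real.cos (∑ k, κ n k * y k)) (C := 1)
        measure_ball_lt_top (fun y _ => by rw [Real.norm_eq_abs]; exact Real.abs_cos_le_one _)
      rw [Real.norm_eq_abs, one_mul] at h
      exact h
    have hx : Real.pi ≤ ‖κ n‖ * (L / 2) := pi_le_norm_mul_half hL hκ h0
    have hx0 : 0 < ‖κ n‖ * (L / 2) := Real.pi_pos.trans_le hx
    have hsinc : Real.sinc (‖κ n‖ * (L / 2)) ≤ 1 / 3 := by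
      refine (Real.sinc_le_inv_abs hx0.ne').trans ?_
      rw [abs_of_pos hx0, inv_le_comm₀ hx0 (by norm_num : (0 : ℝ) < 1 / 3)]
      linarith [Real.pi_gt_three]
    have h1 := (abs_le.1 hav).1
    linarith

end Lattice

end Summit.AtomisticToContinuum.BoseEinsteinCondensation.Theorems.SubharmonicContinuation

end
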